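import Summits.CriticalPhenomena.Ising3DConformalLimit.Theorems.EnergyNotSigmaSquaredRungOneAdjacentMergingDefs
import Literature.Probability.LatticeModels.IntersectionSecondMoment
import Literature.Probability.LatticeModels.BoxTwoPointTransfer
import Literature.Probability.LatticeModels.IntersectionPropertyLatticePrelim
import Literature.Probability.LatticeModels.CriticalTwoPointBounds
import Literature.Probability.LatticeModels.WeightedCurrentsDictionary
import HarnessLib

/-!
# Box passage `Λ_n ↑ ℤ³` of the second-moment weights
(stub `stub_boxPassage` of the line `dominant-shell-concentration` for the crux `RungOneAdjacentMerging`,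
item stmt-CriticalPhenomena-11262, route `EnergyNotSigmaSquared`)

"We work with finite `Λ` and then take the limit as `Λ ↗ ℤ^d`" (Aizenman–Duminil-Copin 2021,
arXiv:1912.07973, Appendix A.2). INFINITE-VOLUME weights `(U, c)` at level `η` for the far point `x`
(`InfVolWeights η x`: `Σ_{u,v∈U} c c T₁T₂ ≤ (1+η) G(x)² (Σ_{u∈U} c·dens·dens')²`, mean positive) are
moved into the free box `Λ_n = box 3 n` with the induced nearest-neighbour graph
`(zdGraph 3).comap Subtype.val` on `↥(box 3 n)` at `β_c(3)`: for all large `n` they give finite-volume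
second-moment data `SecondMomentData … θ o a y y'` at any level `θ > η`, nails `o = 0`, `a = e₂`,
`y = x`, `y' = x + e₂`.

Proof.  Pure bookkeeping in three layers.
* `secondMomentData_of_kernel` — on ANY finite graph with constant coupling `β ≥ 0`, if the pair
  current sums factor through a real kernel, `Z[{p}∆{q}] = S(p,q)·Z[∅]` (all `Z` finite), then for real
  weights `w ≥ 0` the `ℝ≥0∞` quantities `fvMean`, `fvSecond` are `Z[∅]⁴·M`, `Z[∅]⁶·Q` with the obvious
  real sums `M`, `Q`, and `SecondMomentData` follows from `0 < M` and `S(o,y)S(a,y')·Q ≤ (1+θ)M²`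
  (`ENNReal.toReal` throughout).
* `secondMomentData_subtype` — on the induced graph of `Λ ⊆ ℤ^d`, weights `c·1_U` (`U ⊆ Λ`) turn the
  sums over the vertex type `↥Λ` into sums over `U`.
* `eventually_lt_of_tendsto_kernel` — if kernels `S_n(p,q) → G(q-p)` pointwise (finitely many pairs),
  then `M_n → G(x)²·m`, `Q_n → Σ c c T₁T₂`, `S_n(0,x)S_n(e₂,x+e₂) → G(x)²`, and the strict room `η < θ`
  (`m > 0`, `G(x) > 0`) gives `0 < M_n` and `P_n Q_n < (1+θ) M_n²` eventually
  (`Filter.Tendsto.eventually_lt`).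
The stub feeds in the random-current dictionary `Z[{p}∆{q}] = Z[∅]·⟨σ_pσ_q⟩^∅_{Λ_n}`
(`toReal_ecurrentSum_pair_eq_mul_isingTwoPoint`), the box limit
`⟨σ_pσ_q⟩^∅_{Λ_n;β_c} → S^f_{β_c}(q-p)` (`tendsto_isingTwoPoint_box_sub`) and `S^f_{β_c} = S⁺_{β_c} = G`
for `d = 3` (`twoPointPlus_criticalBeta_eq_twoPointFree_holds`), and `U ⊆ Λ_n` eventually
(`eventually_mem_box`).

References: M. Aizenman, H. Duminil-Copin, Ann. of Math. 194 (2021), arXiv:1912.07973, Appendix A.2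
and §6.2 (6.5) [AizenmanDuminilCopinAnnals2021].
-/

noncomputable section

open MeasureTheory Filter Finset
open scoped BigOperators ENNReal symmDiff Topology
open Literature.Probability.LatticeModels

namespace Summit.CriticalPhenomena.Ising3DConformalLimit.RungOneAdjacentMergingDominantShell

/-! ### Layer 1: any finite graph — `fvMean`, `fvSecond` through a real kernel -/

/-- **Second-moment data from a real kernel.** On a finite graph with constant coupling `β ≥ 0`, if
`Z[{p}∆{q}] = S(p,q)·Z[∅]` for a real kernel `S`, then for real weights `w ≥ 0` with
`0 < M := Σ_p w(p) S(o,p)S(p,y)S(a,p)S(p,y')` and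
`S(o,y)S(a,y')·Σ_{p,q} w(p)w(q) T_{oy}(p,q)T_{ay'}(p,q) ≤ (1+θ)M²`
(`T_{oy}(p,q) = S(o,p)S(p,q)S(q,y) + S(o,q)S(q,p)S(p,y)`), the weights `ofReal ∘ w` are second-moment
data at level `θ` (`fvMean = Z[∅]⁴M`, `fvSecond = Z[∅]⁶Q`, `Z[oy]Z[ay'] = Z[∅]²S(o,y)S(a,y')`). [folklore] -/
theorem secondMomentData_of_kernel {V : Type} [Fintype V] [DecidableEq V] (G : SimpleGraph V)
    [DecidableRel G.Adj] {β θ : ℝ} (hβ : 0 ≤ β) (hθ : 0 ≤ θ) (S : V → V → ℝ)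
    (hS : ∀ p q : V, (ecurrentSum (fun _ : ↥G.edgeFinset => β) ({p} ∆ {q})).toReal =
      S p q * (ecurrentSum (fun _ : ↥G.edgeFinset => β) ∅).toReal)
    (w : V → ℝ) (hw : ∀ p, 0 ≤ w p) (o a y y' : V)
    (hM : 0 < ∑ p, w p * ((S o p * S p y) * (S a p * S p y')))
    (hPQ : S o y * S a y' * ∑ p, ∑ q, w p * w q *
        ((S o p * S p q * S q y + S o q * S q p * S p y) *
          (S a p * S p q * S q y' + S a q * S q p * S p y')) ≤
      (1 + θ) * (∑ p, w p * ((S o p * S p y) * (S a p * S p y'))) ^ 2) :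
    SecondMomentData G β θ o a y y' := by
  set M : ℝ := ∑ p, w p * ((S o p * S p y) * (S a p * S p y')) with hM_def
  set Q : ℝ := ∑ p, ∑ q, w p * w q *
      ((S o p * S p q * S q y + S o q * S q p * S p y) *
        (S a p * S p q * S q y' + S a q * S q p * S p y')) with hQ_def
  have hK : ∀ e : ↥G.edgeFinset, 0 ≤ (fun _ : ↥G.edgeFinset => β) e := fun _ => hβ
  have hZ : ∀ A : Finset V, ecurrentSum (fun _ : ↥G.edgeFinset => β) A ≠ ∞ := fun A =>
    ecurrentSum_ne_top hK A
  set z : ℝ := (ecurrentSum (fun _ : ↥G.edgeFinset => β) ∅).toReal with hz_def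
  have hz : 0 < z := ENNReal.toReal_pos (ecurrentSum_empty_ne_zero _) (hZ ∅)
  -- the two-step bounds are finite, with real form `z³ · T`
  have h3 : ∀ A B C : Finset V, ecurrentSum (fun _ : ↥G.edgeFinset => β) A *
      ecurrentSum (fun _ : ↥G.edgeFinset => β) B *
        ecurrentSum (fun _ : ↥G.edgeFinset => β) C ≠ ∞ :=
    fun A B C => ENNReal.mul_ne_top (ENNReal.mul_ne_top (hZ A) (hZ B)) (hZ C)
  have hTtop : ∀ o' y'' p q : V,
      Current.twoStepBound (fun _ : ↥G.edgeFinset => β) o' y'' p q ≠ ∞ :=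
    fun _ _ _ _ => ENNReal.add_ne_top.2 ⟨h3 _ _ _, h3 _ _ _⟩
  have hT : ∀ o' y'' p q : V, (Current.twoStepBound (fun _ : ↥G.edgeFinset => β) o' y'' p q).toReal =
      z ^ 3 * (S o' p * S p q * S q y'' + S o' q * S q p * S p y'') := by
    intro o' y'' p q
    unfold Current.twoStepBound
    rw [ENNReal.toReal_add (h3 _ _ _) (h3 _ _ _)]
    simp only [ENNReal.toReal_mul, hS]
    ring
  have hw' : ∀ p, (ENNReal.ofReal (w p)).toReal = w p := fun p => ENNReal.toReal_ofReal (hw p)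
  -- the mean
  have h4 : ∀ p : V, ENNReal.ofReal (w p) *
      ((ecurrentSum (fun _ : ↥G.edgeFinset => β) ({o} ∆ {p}) *
          ecurrentSum (fun _ : ↥G.edgeFinset => β) ({p} ∆ {y})) *
        (ecurrentSum (fun _ : ↥G.edgeFinset => β) ({a} ∆ {p}) *
          ecurrentSum (fun _ : ↥G.edgeFinset => β) ({p} ∆ {y'}))) ≠ ∞ := fun p =>
    ENNReal.mul_ne_top ENNReal.ofReal_ne_top
      (ENNReal.mul_ne_top (ENNReal.mul_ne_top (hZ _) (hZ _)) (ENNReal.mul_ne_top (hZ _) (hZ _)))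
  have hmean_top : fvMean G β o a y y' (fun p => ENNReal.ofReal (w p)) ≠ ∞ :=
    ENNReal.sum_ne_top.2 fun p _ => h4 p
  have hmean : (fvMean G β o a y y' (fun p => ENNReal.ofReal (w p))).toReal = z ^ 4 * M := by
    unfold fvMean
    rw [ENNReal.toReal_sum fun p _ => h4 p, hM_def, Finset.mul_sum]
    refine Finset.sum_congr rfl fun p _ => ?_
    simp only [ENNReal.toReal_mul, hw', hS]
    ring
  -- the second-moment bound
  have h6 : ∀ p q : V, ENNReal.ofReal (w p) * ENNReal.ofReal (w q) *
      (Current.twoStepBound (fun _ : ↥G.edgeFinset => β) o y p q *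
        Current.twoStepBound (fun _ : ↥G.edgeFinset => β) a y' p q) ≠ ∞ := fun p q =>
    ENNReal.mul_ne_top (ENNReal.mul_ne_top ENNReal.ofReal_ne_top ENNReal.ofReal_ne_top)
      (ENNReal.mul_ne_top (hTtop _ _ _ _) (hTtop _ _ _ _))
  have hsecond_top : fvSecond G β o a y y' (fun p => ENNReal.ofReal (w p)) ≠ ∞ :=
    ENNReal.sum_ne_top.2 fun p _ => ENNReal.sum_ne_top.2 fun q _ => h6 p q
  have hsecond : (fvSecond G β o a y y' (fun p => ENNReal.ofReal (w p))).toReal = z ^ 6 * Q := by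
    unfold fvSecond
    rw [ENNReal.toReal_sum fun p _ => ENNReal.sum_ne_top.2 fun q _ => h6 p q, hQ_def, Finset.mul_sum]
    refine Finset.sum_congr rfl fun p _ => ?_
    rw [ENNReal.toReal_sum fun q _ => h6 p q, Finset.mul_sum]
    refine Finset.sum_congr rfl fun q _ => ?_
    simp only [ENNReal.toReal_mul, hw', hT]
    ring
  unfold SecondMomentData
  refine ⟨fun p => ENNReal.ofReal (w p), fun h0 => ?_, hmean_top, ?_⟩
  · -- the mean is nonzero: its real part is `z⁴ M > 0`
    have h1 := hmean
    rw [h0, ENNReal.toReal_zero] at h1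
    exact (mul_pos (pow_pos hz 4) hM).ne' h1.symm
  · -- the inequality, after division by `Z[∅]⁸`
    rw [← ENNReal.toReal_le_toReal (ENNReal.mul_ne_top (ENNReal.mul_ne_top (hZ _) (hZ _)) hsecond_top)
      (ENNReal.mul_ne_top ENNReal.ofReal_ne_top (ENNReal.pow_ne_top hmean_top))]
    simp only [ENNReal.toReal_mul, ENNReal.toReal_pow, hS, hsecond, hmean,
      ENNReal.toReal_ofReal (by linarith : (0 : ℝ) ≤ 1 + θ)]
    calc S o y * z * (S a y' * z) * (z ^ 6 * Q) = z ^ 8 * (S o y * S a y' * Q) := by ring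
      _ ≤ z ^ 8 * ((1 + θ) * M ^ 2) := mul_le_mul_of_nonneg_left hPQ (pow_nonneg hz.le 8)
      _ = (1 + θ) * (z ^ 4 * M) ^ 2 := by ring

/-! ### Layer 2: the induced graph of `Λ ⊆ ℤ^d`, weights supported on `U ⊆ Λ` -/

/-- Weights `c·1_U` with `U ⊆ Λ`: a sum over the vertex type `↥Λ` is a sum over `U`. [folklore] -/
theorem sum_subtype_ite_mul {α : Type*} [DecidableEq α] {Λ U : Finset α} (hU : U ⊆ Λ)
    (c F : α → ℝ) :
    ∑ p : ↥Λ, (if (p : α) ∈ U then c p else 0) * F p = ∑ u ∈ U, c u * F u :=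
  calc ∑ p : ↥Λ, (if (p : α) ∈ U then c p else 0) * F p
        = ∑ u ∈ Λ, (if u ∈ U then c u else 0) * F u :=
          Finset.sum_coe_sort Λ (fun u => (if u ∈ U then c u else 0) * F u)
    _ = ∑ u ∈ U, (if u ∈ U then c u else 0) * F u :=
          (Finset.sum_subset hU fun u _ hu => by rw [if_neg hu, zero_mul]).symm
    _ = ∑ u ∈ U, c u * F u := Finset.sum_congr rfl fun u hu => by rw [if_pos hu]

/-- Weights `c·1_U` with `U ⊆ Λ`: a double sum over `↥Λ` is a double sum over `U`. [folklore] -/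
theorem sum_sum_subtype_ite_mul {α : Type*} [DecidableEq α] {Λ U : Finset α} (hU : U ⊆ Λ)
    (c : α → ℝ) (F : α → α → ℝ) :
    ∑ p : ↥Λ, ∑ q : ↥Λ,
        (if (p : α) ∈ U then c p else 0) * (if (q : α) ∈ U then c q else 0) * F p q =
      ∑ u ∈ U, ∑ v ∈ U, c u * c v * F u v := by
  have inner : ∀ p : α,
      ∑ q : ↥Λ, (if p ∈ U then c p else 0) * (if (q : α) ∈ U then c q else 0) * F p q =
        (if p ∈ U then c p else 0) * ∑ v ∈ U, c v * F p v := by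
    intro p
    rw [← sum_subtype_ite_mul hU c (F p), Finset.mul_sum]
    exact Finset.sum_congr rfl fun q _ => by ring
  calc ∑ p : ↥Λ, ∑ q : ↥Λ,
          (if (p : α) ∈ U then c p else 0) * (if (q : α) ∈ U then c q else 0) * F p q
        = ∑ p : ↥Λ, (if (p : α) ∈ U then c p else 0) * ∑ v ∈ U, c v * F p v :=
          Finset.sum_congr rfl fun p _ => inner p
    _ = ∑ u ∈ U, c u * ∑ v ∈ U, c v * F u v :=
          sum_subtype_ite_mul hU c fun u => ∑ v ∈ U, c v * F u v
    _ = ∑ u ∈ U, ∑ v ∈ U, c u * c v * F u v :=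
          Finset.sum_congr rfl fun u _ => by
            rw [Finset.mul_sum]
            exact Finset.sum_congr rfl fun v _ => by ring

/-- **Second-moment data on the induced graph of `Λ ⊆ ℤ^d`** from weights `c ≥ 0` on `U ⊆ Λ`: if the
pair current sums of `(zdGraph d).comap Subtype.val` (constant coupling `β ≥ 0`) factor through a real
kernel `S` on `ℤ^d`, `Z[{p}∆{q}] = S(p,q)Z[∅]`, and the real mean / second-moment sums over `U` satisfy
`0 < M`, `S(o,y)S(a,y')·Q ≤ (1+θ)M²`, then `SecondMomentData` holds at level `θ ≥ 0`. [folklore] -/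
theorem secondMomentData_subtype {d : ℕ} {Λ U : Finset (Site d)} (hU : U ⊆ Λ) {β θ : ℝ}
    (hβ : 0 ≤ β) (hθ : 0 ≤ θ) (S : Site d → Site d → ℝ)
    (hS : ∀ p q : ↥Λ,
      (ecurrentSum (fun _ : ↥((zdGraph d).comap (Subtype.val : ↥Λ → Site d)).edgeFinset => β)
          ({p} ∆ {q})).toReal =
        S p q * (ecurrentSum
          (fun _ : ↥((zdGraph d).comap (Subtype.val : ↥Λ → Site d)).edgeFinset => β) ∅).toReal)
    {c : Site d → ℝ} (hc : ∀ u, 0 ≤ c u) (o a y y' : ↥Λ)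
    (hM : 0 < ∑ u ∈ U, c u * ((S o u * S u y) * (S a u * S u y')))
    (hPQ : S o y * S a y' * ∑ u ∈ U, ∑ v ∈ U, c u * c v *
        ((S o u * S u v * S v y + S o v * S v u * S u y) *
          (S a u * S u v * S v y' + S a v * S v u * S u y')) ≤
      (1 + θ) * (∑ u ∈ U, c u * ((S o u * S u y) * (S a u * S u y'))) ^ 2) :
    SecondMomentData ((zdGraph d).comap (Subtype.val : ↥Λ → Site d)) β θ o a y y' := by
  have h1 :
      ∑ p : ↥Λ, (if (p : Site d) ∈ U then c p else 0) * ((S o p * S p y) * (S a p * S p y')) =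
        ∑ u ∈ U, c u * ((S o u * S u y) * (S a u * S u y')) :=
    sum_subtype_ite_mul hU c fun u => (S o u * S u y) * (S a u * S u y')
  have h2 : ∑ p : ↥Λ, ∑ q : ↥Λ, (if (p : Site d) ∈ U then c p else 0) *
      (if (q : Site d) ∈ U then c q else 0) *
        ((S o p * S p q * S q y + S o q * S q p * S p y) *
          (S a p * S p q * S q y' + S a q * S q p * S p y')) =
      ∑ u ∈ U, ∑ v ∈ U, c u * c v *
        ((S o u * S u v * S v y + S o v * S v u * S u y) *
          (S a u * S u v * S v y' + S a v * S v u * S u y')) :=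
    sum_sum_subtype_ite_mul hU c fun u v =>
      (S o u * S u v * S v y + S o v * S v u * S u y) * (S a u * S u v * S v y' + S a v * S v u * S u y')
  refine secondMomentData_of_kernel _ hβ hθ (fun p q : ↥Λ => S p q) hS
    (fun p => if (p : Site d) ∈ U then c p else 0) (fun p => ?_) o a y y' ?_ ?_
  · split_ifs
    exacts [hc _, le_rfl]
  · rw [h1]
    exact hM
  · rw [h1, h2]
    exact hPQ

/-! ### Layer 3: the limit `n → ∞` through pointwise convergent kernels -/

/-- **Strict room in the limit.** If real kernels `S_n` on `ℤ³` converge pointwise to the critical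
two-point function, `S_n(p,q) → G(q-p)`, and `(U, c)` are infinite-volume weights at level `η` for `x`
(mean `m > 0`, `Σ c c T₁T₂ ≤ (1+η)G(x)²m²`), then for `θ > η`, eventually in `n`, the kernel mean
`M_n = Σ_u c(u) S_n(0,u)S_n(u,x)S_n(e₂,u)S_n(u,x+e₂)` is positive and
`S_n(0,x)S_n(e₂,x+e₂)·Q_n < (1+θ)M_n²` (`M_n → G(x)²m`, `Q_n → Σ c c T₁T₂`,
`S_n(0,x)S_n(e₂,x+e₂) → G(x)² > 0`). [folklore] -/
theorem eventually_lt_of_tendsto_kernel {x : Site 3} {η θ : ℝ} (hηθ : η < θ) {U : Finset (Site 3)}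
    {c : Site 3 → ℝ} (hm : 0 < ∑ u ∈ U, c u * (dens x u * dens x (u - e₂)))
    (hvar : ∑ u ∈ U, ∑ v ∈ U, c u * c v * (tstep x u v * tstep x (u - e₂) (v - e₂)) ≤
      (1 + η) * Gc x ^ 2 * (∑ u ∈ U, c u * (dens x u * dens x (u - e₂))) ^ 2)
    (S : ℕ → Site 3 → Site 3 → ℝ)
    (hS : ∀ p q : Site 3, Tendsto (fun n => S n p q) atTop (𝓝 (Gc (q - p)))) :
    ∀ᶠ n : ℕ in atTop,
      0 < ∑ u ∈ U, c u * ((S n 0 u * S n u x) * (S n e₂ u * S n u (x + e₂))) ∧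
      S n 0 x * S n e₂ (x + e₂) * ∑ u ∈ U, ∑ v ∈ U, c u * c v *
          ((S n 0 u * S n u v * S n v x + S n 0 v * S n v u * S n u x) *
            (S n e₂ u * S n u v * S n v (x + e₂) + S n e₂ v * S n v u * S n u (x + e₂))) <
        (1 + θ) * (∑ u ∈ U, c u * ((S n 0 u * S n u x) * (S n e₂ u * S n u (x + e₂)))) ^ 2 := by
  have hG : 0 < Gc x := twoPointPlus_pos (criticalBeta_pos_holds (d := 3) (by norm_num)) x
  have hS' : ∀ p q r : Site 3, r = q - p → Tendsto (fun n => S n p q) atTop (𝓝 (Gc r)) := by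
    rintro p q r rfl
    exact hS p q
  set m : ℝ := ∑ u ∈ U, c u * (dens x u * dens x (u - e₂)) with hm_def
  -- the mean
  have hMu : ∀ u : Site 3,
      Tendsto (fun n => c u * ((S n 0 u * S n u x) * (S n e₂ u * S n u (x + e₂)))) atTop
        (𝓝 (c u * ((Gc u * Gc (x - u)) * (Gc (u - e₂) * Gc (x - (u - e₂)))))) := fun u =>
    (((hS' 0 u u (by simp)).mul (hS' u x (x - u) rfl)).mul
      ((hS' e₂ u (u - e₂) rfl).mul (hS' u (x + e₂) (x - (u - e₂)) (by abel)))).const_mul (c u)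
  have hMeq : ∑ u ∈ U, c u * ((Gc u * Gc (x - u)) * (Gc (u - e₂) * Gc (x - (u - e₂)))) =
      Gc x ^ 2 * m := by
    rw [hm_def, Finset.mul_sum]
    refine Finset.sum_congr rfl fun u _ => ?_
    unfold dens
    field_simp
  have hM : Tendsto (fun n => ∑ u ∈ U, c u * ((S n 0 u * S n u x) * (S n e₂ u * S n u (x + e₂))))
      atTop (𝓝 (Gc x ^ 2 * m)) := by
    rw [← hMeq]
    exact tendsto_finsetSum U fun u _ => hMu u
  -- the second-moment bound
  have hQuv : ∀ u v : Site 3, Tendsto (fun n => c u * c v *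
      ((S n 0 u * S n u v * S n v x + S n 0 v * S n v u * S n u x) *
        (S n e₂ u * S n u v * S n v (x + e₂) + S n e₂ v * S n v u * S n u (x + e₂))))
      atTop (𝓝 (c u * c v * (tstep x u v * tstep x (u - e₂) (v - e₂)))) := by
    intro u v
    unfold tstep
    exact ((((hS' 0 u u (by simp)).mul (hS' u v (v - u) rfl)).mul (hS' v x (x - v) rfl)).add
        (((hS' 0 v v (by simp)).mul (hS' v u (u - v) rfl)).mul (hS' u x (x - u) rfl))).mul
      ((((hS' e₂ u (u - e₂) rfl).mul (hS' u v (v - e₂ - (u - e₂)) (by abel))).mul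
          (hS' v (x + e₂) (x - (v - e₂)) (by abel))).add
        (((hS' e₂ v (v - e₂) rfl).mul (hS' v u (u - e₂ - (v - e₂)) (by abel))).mul
          (hS' u (x + e₂) (x - (u - e₂)) (by abel)))) |>.const_mul (c u * c v)
  have hQ : Tendsto (fun n => ∑ u ∈ U, ∑ v ∈ U, c u * c v *
      ((S n 0 u * S n u v * S n v x + S n 0 v * S n v u * S n u x) *
        (S n e₂ u * S n u v * S n v (x + e₂) + S n e₂ v * S n v u * S n u (x + e₂))))
      atTop (𝓝 (∑ u ∈ U, ∑ v ∈ U, c u * c v * (tstep x u v * tstep x (u - e₂) (v - e₂)))) :=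
    tendsto_finsetSum U fun u _ => tendsto_finsetSum U fun v _ => hQuv u v
  -- the two nails-to-nails factors
  have hP : Tendsto (fun n => S n 0 x * S n e₂ (x + e₂)) atTop (𝓝 (Gc x * Gc x)) :=
    (hS' 0 x x (by simp)).mul (hS' e₂ (x + e₂) x (by abel))
  -- strict room
  have hpos : 0 < Gc x ^ 2 * m := mul_pos (pow_pos hG 2) hm
  have hlt : Gc x * Gc x * ∑ u ∈ U, ∑ v ∈ U, c u * c v * (tstep x u v * tstep x (u - e₂) (v - e₂)) <
      (1 + θ) * (Gc x ^ 2 * m) ^ 2 :=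
    calc Gc x * Gc x * ∑ u ∈ U, ∑ v ∈ U, c u * c v * (tstep x u v * tstep x (u - e₂) (v - e₂))
          ≤ Gc x * Gc x * ((1 + η) * Gc x ^ 2 * m ^ 2) :=
            mul_le_mul_of_nonneg_left hvar (mul_nonneg hG.le hG.le)
      _ = (1 + η) * (Gc x ^ 2 * m) ^ 2 := by ring
      _ < (1 + θ) * (Gc x ^ 2 * m) ^ 2 := mul_lt_mul_of_pos_right (by linarith) (pow_pos hpos 2)
  exact (hM.eventually_const_lt hpos).and ((hP.mul hQ).eventually_lt ((hM.pow 2).const_mul (1 + θ)) hlt)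

/-! ### The stub -/

/-- STUB 2 (M) — BOX PASSAGE: infinite-volume weights at level `η` for `x` yield, for all large `n`,
finite-volume second-moment data at any level `θ > η` on the free box graph
`(zdGraph 3).comap Subtype.val` on `↥(box 3 n)` with nails `o = 0, a = e₂, y = x, y' = x + e₂`.
Proof route: `Z[{p}∆{q}] = Z[∅]·⟨σ_pσ_q⟩^free_{Λ_n;β_c}` (`toReal_ecurrentSum_pair_eq_mul_isingTwoPoint`:
random-current representation on the box graph and transport along `Subtype.val`);
`⟨σ_pσ_q⟩^free_{Λ_n;β_c} → S^f_{β_c}(q - p) = G(q - p)` (`tendsto_isingTwoPoint_box_sub`,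
`twoPointPlus_criticalBeta_eq_twoPointFree_holds`); finitely many pairs (`U ∪ {0, e₂, x, x+e₂}`),
`fvMean/Z[∅]⁴ → G(x)²·m > 0`, `fvSecond/Z[∅]⁶ → Σ c c T₁T₂`, `Z[0x]Z[e₂,x+e₂]/Z[∅]² → G(x)²`; strict
room `η < θ` gives the inequality eventually; weights transported as `c·1_U ∘ Subtype.val` (support
inside the box eventually, `eventually_mem_box`). [cite: AizenmanDuminilCopinAnnals2021, arXiv:1912.07973 Appendix A.2 ("We work with finite Λ and then take the limit")] -/
theorem stub_boxPassage :
    ∀ (x : Site 3) (η θ : ℝ), 0 < η → η < θ → InfVolWeights η x →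
      ∃ n₀ : ℕ, ∀ n : ℕ, n₀ ≤ n → ∀ o a y y' : ↥(box 3 n),
        (o : Site 3) = 0 → (a : Site 3) = Pi.single 1 1 → (y : Site 3) = x →
        (y' : Site 3) = x + Pi.single 1 1 →
          SecondMomentData ((zdGraph 3).comap (Subtype.val : ↥(box 3 n) → Site 3))
            (criticalBeta 3) θ o a y y' := by
  intro x η θ hη hηθ hW
  obtain ⟨U, c, hc, hm, hvar⟩ := hW
  have hβ0 : 0 ≤ criticalBeta 3 := criticalBeta_nonneg 3
  -- the box two-point functions converge to the critical two-point function
  have hS : ∀ p q : Site 3, Tendsto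
      (fun n : ℕ => isingTwoPoint (zdGraph 3) (box 3 n) (criticalBeta 3) 0 .free p q) atTop
      (𝓝 (Gc (q - p))) := by
    intro p q
    have h := tendsto_isingTwoPoint_box_sub (d := 3) hβ0 p q
    rwa [← twoPointPlus_criticalBeta_eq_twoPointFree_holds (d := 3) (by norm_num) (q - p)] at h
  have hev := eventually_lt_of_tendsto_kernel hηθ hm hvar
    (fun n p q => isingTwoPoint (zdGraph 3) (box 3 n) (criticalBeta 3) 0 .free p q) hS
  have hUev : ∀ᶠ n : ℕ in atTop, ∀ u ∈ U, u ∈ box 3 n :=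
    U.eventually_all.2 fun u _ => eventually_mem_box u
  obtain ⟨n₀, hn₀⟩ := eventually_atTop.1 (hUev.and hev)
  refine ⟨n₀, fun n hn o a y y' ho ha hy hy' => ?_⟩
  obtain ⟨hUn, hMn, hltn⟩ := hn₀ n hn
  refine secondMomentData_subtype (fun u hu => hUn u hu) hβ0 (hη.trans hηθ).le
    (fun p q => isingTwoPoint (zdGraph 3) (box 3 n) (criticalBeta 3) 0 .free p q)
    (fun p q => (toReal_ecurrentSum_pair_eq_mul_isingTwoPoint (box 3 n) hβ0 p q).trans (mul_comm _ _))
    hc o a y y' ?_ ?_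
  · rw [ho, ha, hy, hy']
    exact hMn
  · rw [ho, ha, hy, hy']
    exact hltn.le

end Summit.CriticalPhenomena.Ising3DConformalLimit.RungOneAdjacentMergingDominantShell

end
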